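import Summits.CriticalPhenomena.PercolationContinuityZ3.Theses.PercNearOneGluing
import Literature.Probability.Percolation.TwoClusterConditionalAssociationProofs
import Literature.Probability.Percolation.TwoClusterExchange
import Literature.Probability.Percolation.KozmaNitzanPreFKG
import Summits.CriticalPhenomena.PercolationContinuityZ3.Theorems.PercNearOneGluingAdditiveGluingML5EdgeIdentity
import Summits.CriticalPhenomena.PercolationContinuityZ3.Theorems.PercNearOneGluingNearOneGluingS2OfS1Gen
import HarnessLib

/-!
# Crux `PercNearOneGluing.AdditiveGluing` (stmt-CriticalPhenomena-4576): domain-Markov decomposition of `{u ↔ b}` over `C_v` (tools for (SD) ⟹ (T))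

Support file (`--supports stmt-CriticalPhenomena-4576`, helper; depth seat (d) exchange-certificate form).
No definitions, no named facts, no sorries.

Weighted graph on `Fin n` (`μ = prodBernoulli w`), relays `u, v`, target `b`, observer `o`, spectator `c`; `D = {u ↮ v}`,
`N = {c ↮ u} ∩ {c ↮ v}`, `L = C_v` (open edge cluster).  The registered kernel stub of the three-relay half,
`stub_k0CovTransferQ_c9` (= (T), hypothesis `hQ` of `k0CovTransferP_of_Q`, p-landed by lead c10), reads
  (T)  `μ(D)·(μ(D∩ub∩vo)·μ(N) − μ(D∩ub∩vc)·μ(N∩oc)) ≤ μ(D∩ub)·(μ(D∩vo)·μ(N) − μ(D∩vc)·μ(N∩oc))`.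
Lead c11 (`LeadMath-c11` §1–§2) reduced it on paper to the L-face dominance statement
  (SD)  for every event `U` increasing in `C_v`:
        `μ(D∩N∩oc)·(μ(D)·μ(D∩U∩vc) − μ(D∩U)·μ(D∩vc)) ≤ μ(D∩N)·(μ(D)·μ(D∩U∩vo) − μ(D∩U)·μ(D∩vo))`,
i.e. `Cov_D(1_U, 1{o∈L}) ≥ P_D(o↔c | c free)·Cov_D(1_U, 1{c∈L})`, of which the cases `U` comparable with `{c ∈ L}` are proved in
`PercNearOneGluingAdditiveGluingThreePointTransferUpset.lean`.  The reduction (SD) ⟹ (T) is `PercNearOneGluingAdditiveGluingK0CovTransferQOfSD.lean`; THIS file supplies its tool,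
the domain-Markov decomposition below (namespace `K0CovTransferQOfSD`).  Summary of the two files:

* `covTransferD_of_SD` : (SD) ⟹ (T_D), the all-conditional transfer
  `μ(D∩N)·(μ(D)·μ(D∩ub∩vo) − μ(D∩ub)·μ(D∩vo)) ≤ μ(D∩N∩oc)·(μ(D)·μ(D∩ub∩vc) − μ(D∩ub)·μ(D∩vc))`.
  Proof (domain Markov property, van den Berg–Häggström–Kahn's display (10), in the tree `BHK2006.sum_cond_cluster`):
  conditionally on `C_v`, `{u ↔ b}` is the event that `b` is joined to `u` in fresh variables `η` off `C̄_v`; for each auxiliary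
  configuration `η` the event `U_η = {ω | u ↮ b in η ∖ C̄_v(ω)}` is increasing in `C_v(ω)`, and
  `μ(D∩ub∩E) = Σ_η weight(η)·(μ(D∩E) − μ(D∩E∩U_η))` for `E ∈ {Ω, v↔o, v↔c}`; so both covariances are `−Σ_η weight(η)·[same with U_η]`
  and (T_D) is the `weight(η)`-average of (SD) at `U_η`.
* `k0CovTransferQ_of_SD` : (SD) + the attachment transfer on `D` (registered stub `stub_k0AttachTransferD_c10`, landed p183587, taken
  as hypothesis `hA` exactly as in `k0CovTransferP_of_Q`) ⟹ (T) at all tuples, i.e. the registered signature of `stub_k0CovTransferQ_c9`.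
  Proof: (T_D), `Cov_D(ub, vc) ≤ 0` (BHK Thm. 1.5, `twoClusterExchange`), and `μ(D∩N)·μ(N∩oc) ≤ μ(D∩N∩oc)·μ(N)` (= `hA`); the degenerate
  case `μ(D∩N) = 0` forces `μ(D)·μ(N) = 0` (the configuration of sure edges lies in `D ∩ N` whenever both are non-null).
[cite: VandenbergHaggstromKahn2005, Thm. 1.5 (p. 7), proof pp. 7–8 display (10)] [cite: KozmaNitzan2024, Lemma 4 (p. 9), Question 7 (p. 36)]
-/

namespace Summit.CriticalPhenomena.PercolationContinuityZ3.Theorems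

open MeasureTheory Set Literature.Probability.LatticeModels Literature.Probability.Percolation
open Literature.Probability.Percolation.BHK2006 (weight weight_nonneg integral_prodBernoulli_eq_sum sum_cond_cluster bar_mono
  openEdgeCluster_mono)
open Literature.Probability.Percolation.DecisionTree (ind ind_of_mem ind_of_not_mem ind_nonneg)

noncomputable section

namespace K0CovTransferQOfSD

open scoped Classical

variable {n : ℕ}

/-! ### Finite-sum form of the measure: `s1gen_measureReal_eq_sum`, `s1gen_sum_weight` (landed, S2OfS1Gen) -/

/-! ### The auxiliary events `V_η` ("u ↔ b in the fresh variables off C̄_v") and `U_η = V_ηᶜ` -/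

/-- `1{u ↔ b}(ω) = 1{b = u ∨ ∃ e ∈ C_u ω, b ∈ e}` (as a real `if`). [folklore] -/
theorem ind_openConn_eq_connInd (u b : Fin n) (ω : BondConfig (Fin n)) :
    ind (openConn u b : Set (BondConfig (Fin n))) ω =
      (if b = u ∨ ∃ e ∈ openEdgeCluster ω u, b ∈ e then (1 : ℝ) else 0) := by
  by_cases h : (openGraph ω).Reachable u b
  · rw [ind_of_mem (show ω ∈ (openConn u b : Set (BondConfig (Fin n))) from h),
      if_pos ((reachable_iff_exists_mem_openEdgeCluster ω u b).1 h)]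
  · rw [ind_of_not_mem (show ω ∉ (openConn u b : Set (BondConfig (Fin n))) from h),
      if_neg (fun h' => h ((reachable_iff_exists_mem_openEdgeCluster ω u b).2 h'))]

/-- `1{u ↔ b in η ∖ C̄_v(ω)}` as a real `if` equals the indicator of the auxiliary event
`V_η = {ω | u ↔ b in η ∖ C̄_v(ω)}` (written out; `C̄ = ` the pairs meeting `{v} ∪ V(C)`). [folklore] -/
theorem connInd_fresh_eq_ind_Vaux (u v b : Fin n) (η ω : Set (Sym2 (Fin n))) :
    (if b = u ∨ ∃ e ∈ openEdgeCluster (η \ {d | ∃ y ∈ d, y = v ∨ ∃ d' ∈ openEdgeCluster ω v, y ∈ d'}) u, b ∈ e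
      then (1 : ℝ) else 0) =
      ind ({ω' | b = u ∨ ∃ e ∈ openEdgeCluster (η \ {d | ∃ y ∈ d, y = v ∨ ∃ d' ∈ openEdgeCluster ω' v, y ∈ d'}) u, b ∈ e} : Set (BondConfig (Fin n))) ω := by
  by_cases h : ω ∈ ({ω' | b = u ∨ ∃ e ∈ openEdgeCluster (η \ {d | ∃ y ∈ d, y = v ∨ ∃ d' ∈ openEdgeCluster ω' v, y ∈ d'}) u, b ∈ e} : Set (BondConfig (Fin n)))
  · rw [ind_of_mem h, if_pos (by exact h)]
  · rw [ind_of_not_mem h, if_neg (by exact h)]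

/-- **`U_η := V_ηᶜ` is increasing in `C_v`**: enlarging `C_v` enlarges `C̄_v`, shrinks the fresh configuration `η ∖ C̄_v` and
its cluster of `u`. [folklore] -/
theorem compl_Vaux_mono (u v b : Fin n) (η : Set (Sym2 (Fin n))) ⦃ω₁ ω₂ : BondConfig (Fin n)⦄
    (h : openEdgeCluster ω₁ v ⊆ openEdgeCluster ω₂ v)
    (hω : ω₁ ∈ ({ω' | b = u ∨ ∃ e ∈ openEdgeCluster (η \ {d | ∃ y ∈ d, y = v ∨ ∃ d' ∈ openEdgeCluster ω' v, y ∈ d'}) u, b ∈ e} : Set (BondConfig (Fin n)))ᶜ) :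
    ω₂ ∈ ({ω' | b = u ∨ ∃ e ∈ openEdgeCluster (η \ {d | ∃ y ∈ d, y = v ∨ ∃ d' ∈ openEdgeCluster ω' v, y ∈ d'}) u, b ∈ e} : Set (BondConfig (Fin n)))ᶜ := by
  intro h'
  apply hω
  rcases h' with hbu | ⟨e, he, hbe⟩
  · exact Or.inl hbu
  · refine Or.inr ⟨e, openEdgeCluster_mono (Set.sdiff_subset_sdiff_right (bar_mono v h)) u he, hbe⟩

/-! ### The domain Markov decomposition `μ(D ∩ ub ∩ E) = Σ_η weight(η)·μ(D ∩ E ∩ V_η)` -/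

/-- For an event `E` read off `C_v` through a real function `F` (`1_E(ω) = F(C_v ω)`):
`μ(D ∩ E ∩ {u↔b}) = Σ_η weight(η) · μ(D ∩ E ∩ V_η)`.
[cite: VandenbergHaggstromKahn2005, §1 pp. 7–8, display (10)] -/
theorem real_D_E_ub_eq_sum (w : Sym2 (Fin n) → unitInterval) (b u v : Fin n) (E : Set (BondConfig (Fin n)))
    (F : Set (Sym2 (Fin n)) → ℝ) (hF : ∀ ω, ind E ω = F (openEdgeCluster ω v)) :
    (prodBernoulli w).real ((openConn u v)ᶜ ∩ E ∩ openConn u b : Set (BondConfig (Fin n))) =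
      ∑ η, weight (fun e => (w e : ℝ)) η *
        (prodBernoulli w).real ((openConn u v)ᶜ ∩ E ∩ ({ω' | b = u ∨ ∃ e ∈ openEdgeCluster (η \ {d | ∃ y ∈ d, y = v ∨ ∃ d' ∈ openEdgeCluster ω' v, y ∈ d'}) u, b ∈ e} : Set (BondConfig (Fin n))) : Set (BondConfig (Fin n))) := by
  set w' : Sym2 (Fin n) → ℝ := fun e => (w e : ℝ) with hw'
  set D : Set (BondConfig (Fin n)) := (openConn u v)ᶜ with hD
  have hDmem : ∀ ω, ω ∈ D ↔ ¬ (openGraph ω).Reachable v u := by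
    intro ω; rw [hD, KNPreFKG.openConn_symm u v]; rfl
  have hm : ∑ ω, weight w' ω = 1 := s1gen_sum_weight w
  -- left side as a sum, pointwise `1_{D∩E∩ub} = F(C_v)·1{u↔b}(C_u)·1_D`
  have hL : (prodBernoulli w).real (D ∩ E ∩ openConn u b) =
      ∑ ω, weight w' ω * ((F (openEdgeCluster ω v) * (if b = u ∨ ∃ e ∈ openEdgeCluster ω u, b ∈ e then (1 : ℝ) else 0)) * ind D ω) := by
    rw [s1gen_measureReal_eq_sum]
    refine Finset.sum_congr rfl fun ω _ => ?_
    congr 1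
    rw [← hF, ← ind_openConn_eq_connInd]
    by_cases h1 : ω ∈ D <;> by_cases h2 : ω ∈ E <;> by_cases h3 : ω ∈ (openConn u b : Set (BondConfig (Fin n))) <;>
      simp [ind_of_mem, ind_of_not_mem, h1, h2, h3, mem_inter_iff]
  -- right side fibres as sums
  have hR : ∀ η, (prodBernoulli w).real (D ∩ E ∩ ({ω' | b = u ∨ ∃ e ∈ openEdgeCluster (η \ {d | ∃ y ∈ d, y = v ∨ ∃ d' ∈ openEdgeCluster ω' v, y ∈ d'}) u, b ∈ e} : Set (BondConfig (Fin n)))) =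
      ∑ ω, weight w' ω * ((F (openEdgeCluster ω v) *
        (if b = u ∨ ∃ e ∈ openEdgeCluster (η \ {d | ∃ y ∈ d, y = v ∨ ∃ d' ∈ openEdgeCluster ω v, y ∈ d'}) u, b ∈ e then (1 : ℝ) else 0)) * ind D ω) := by
    intro η
    rw [s1gen_measureReal_eq_sum]
    refine Finset.sum_congr rfl fun ω _ => ?_
    congr 1
    rw [← hF, connInd_fresh_eq_ind_Vaux]
    by_cases h1 : ω ∈ D <;> by_cases h2 : ω ∈ E <;> by_cases h3 : ω ∈ ({ω' | b = u ∨ ∃ e ∈ openEdgeCluster (η \ {d | ∃ y ∈ d, y = v ∨ ∃ d' ∈ openEdgeCluster ω' v, y ∈ d'}) u, b ∈ e} : Set (BondConfig (Fin n))) <;>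
      simp [ind_of_mem, ind_of_not_mem, h1, h2, h3, mem_inter_iff]
  -- domain Markov (BHK (10)) with `H(C_v, C_u) = F(C_v)·1{u↔b}(C_u)`
  have key := sum_cond_cluster w' hm v u (fun C C' => F C * (if b = u ∨ ∃ e ∈ C', b ∈ e then (1 : ℝ) else 0)) hDmem
  rw [hL, key]
  simp_rw [hR]
  -- exchange the two finite sums
  calc ∑ ω, weight w' ω * ((∑ η, weight w' η * (F (openEdgeCluster ω v) *
          (if b = u ∨ ∃ e ∈ openEdgeCluster (η \ {d | ∃ y ∈ d, y = v ∨ ∃ d' ∈ openEdgeCluster ω v, y ∈ d'}) u, b ∈ e then (1 : ℝ) else 0))) * ind D ω)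
      = ∑ ω, ∑ η, weight w' η * (weight w' ω * ((F (openEdgeCluster ω v) *
          (if b = u ∨ ∃ e ∈ openEdgeCluster (η \ {d | ∃ y ∈ d, y = v ∨ ∃ d' ∈ openEdgeCluster ω v, y ∈ d'}) u, b ∈ e then (1 : ℝ) else 0)) * ind D ω)) := by
        refine Finset.sum_congr rfl fun ω _ => ?_
        rw [Finset.sum_mul, Finset.mul_sum]
        refine Finset.sum_congr rfl fun η _ => ?_
        ring
    _ = ∑ η, ∑ ω, weight w' η * (weight w' ω * ((F (openEdgeCluster ω v) *
          (if b = u ∨ ∃ e ∈ openEdgeCluster (η \ {d | ∃ y ∈ d, y = v ∨ ∃ d' ∈ openEdgeCluster ω v, y ∈ d'}) u, b ∈ e then (1 : ℝ) else 0)) * ind D ω)) := Finset.sum_comm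
    _ = _ := by
        refine Finset.sum_congr rfl fun η _ => ?_
        rw [Finset.mul_sum]

/-- The three instances `E = Ω`, `E = {v↔o}`, `E = {v↔c}` of `real_D_E_ub_eq_sum`, with `μ(D∩E∩V_η) = μ(D∩E) − μ(D∩E∩V_ηᶜ)`.
[folklore] -/
theorem real_D_conn_ub_eq (w : Sym2 (Fin n) → unitInterval) (x b u v : Fin n) :
    (prodBernoulli w).real ((openConn u v)ᶜ ∩ openConn u b ∩ openConn v x : Set (BondConfig (Fin n))) =
      ∑ η, weight (fun e => (w e : ℝ)) η *
        ((prodBernoulli w).real ((openConn u v)ᶜ ∩ openConn v x : Set (BondConfig (Fin n))) -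
          (prodBernoulli w).real ((openConn u v)ᶜ ∩ ({ω' | b = u ∨ ∃ e ∈ openEdgeCluster (η \ {d | ∃ y ∈ d, y = v ∨ ∃ d' ∈ openEdgeCluster ω' v, y ∈ d'}) u, b ∈ e} : Set (BondConfig (Fin n)))ᶜ ∩ openConn v x : Set (BondConfig (Fin n)))) := by
  have h := real_D_E_ub_eq_sum w b u v (openConn v x) (fun C => if x = v ∨ ∃ e ∈ C, x ∈ e then (1 : ℝ) else 0) (fun ω => ind_openConn_eq_connInd v x ω)
  rw [show ((openConn u v)ᶜ ∩ openConn u b ∩ openConn v x : Set (BondConfig (Fin n))) =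
      (openConn u v)ᶜ ∩ openConn v x ∩ openConn u b from by ext ω; simp only [mem_inter_iff]; tauto, h]
  refine Finset.sum_congr rfl fun η _ => ?_
  congr 1
  have hs := ML5EdgeIdentity.real_eq_inter_add_inter_compl w
    ((openConn u v)ᶜ ∩ openConn v x : Set (BondConfig (Fin n))) (({ω' | b = u ∨ ∃ e ∈ openEdgeCluster (η \ {d | ∃ y ∈ d, y = v ∨ ∃ d' ∈ openEdgeCluster ω' v, y ∈ d'}) u, b ∈ e} : Set (BondConfig (Fin n))))
  rw [show ((openConn u v)ᶜ ∩ openConn v x ∩ ({ω' | b = u ∨ ∃ e ∈ openEdgeCluster (η \ {d | ∃ y ∈ d, y = v ∨ ∃ d' ∈ openEdgeCluster ω' v, y ∈ d'}) u, b ∈ e} : Set (BondConfig (Fin n)))ᶜ : Set (BondConfig (Fin n))) =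
      (openConn u v)ᶜ ∩ ({ω' | b = u ∨ ∃ e ∈ openEdgeCluster (η \ {d | ∃ y ∈ d, y = v ∨ ∃ d' ∈ openEdgeCluster ω' v, y ∈ d'}) u, b ∈ e} : Set (BondConfig (Fin n)))ᶜ ∩ openConn v x from inter_right_comm _ _ _] at hs
  linarith

/-- `μ(D ∩ {u↔b}) = Σ_η weight(η)·(μ(D) − μ(D ∩ U_η))` (the case `E = Ω` of `real_D_E_ub_eq_sum`).
[cite: VandenbergHaggstromKahn2005, §1 pp. 7–8, display (10)] -/
theorem real_D_ub_eq (w : Sym2 (Fin n) → unitInterval) (b u v : Fin n) :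
    (prodBernoulli w).real ((openConn u v)ᶜ ∩ openConn u b : Set (BondConfig (Fin n))) =
      ∑ η, weight (fun e => (w e : ℝ)) η *
        ((prodBernoulli w).real ((openConn u v)ᶜ : Set (BondConfig (Fin n))) -
          (prodBernoulli w).real ((openConn u v)ᶜ ∩ ({ω' | b = u ∨ ∃ e ∈ openEdgeCluster (η \ {d | ∃ y ∈ d, y = v ∨ ∃ d' ∈ openEdgeCluster ω' v, y ∈ d'}) u, b ∈ e} : Set (BondConfig (Fin n)))ᶜ : Set (BondConfig (Fin n)))) := by
  have h := real_D_E_ub_eq_sum w b u v univ (fun _ => 1) (fun ω => by rw [ind_of_mem (mem_univ ω)])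
  rw [inter_univ] at h
  rw [h]
  refine Finset.sum_congr rfl fun η _ => ?_
  congr 1
  have hs := ML5EdgeIdentity.real_eq_inter_add_inter_compl w ((openConn u v)ᶜ : Set (BondConfig (Fin n))) (({ω' | b = u ∨ ∃ e ∈ openEdgeCluster (η \ {d | ∃ y ∈ d, y = v ∨ ∃ d' ∈ openEdgeCluster ω' v, y ∈ d'}) u, b ∈ e} : Set (BondConfig (Fin n))))
  linarith

end K0CovTransferQOfSD

end

end Summit.CriticalPhenomena.PercolationContinuityZ3.Theorems
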